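import Mathlib
import HarnessLib

/-!
# Integrals over a parallelogram as box integrals: the affine image of the unit square

**Statement.** For `a u v : ℝ × ℝ` let `P = convexHull ℝ {a, a + u, a + v, a + u + v}` be the (closed, possibly
degenerate) parallelogram with vertex `a` and edge vectors `u`, `v`, and `D = parallelogramDet u v = u₁ v₂ - u₂ v₁`.
For every `f : ℝ × ℝ → ℝ` integrable on `P`,

* `∫ p in P, f p = |D| * ∫ s in 0..1, ∫ t in 0..1, f (a + s • u + t • v)` (`setIntegral_parallelogram_eq_iterated`)
  — the nonsingular affine change of variables with constant Jacobian `|D|` of Davis–Rabinowitz (5.4.7)–(5.4.8)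
  ("integration rules over parallelograms … are therefore easy to develop"), composed with Fubini on the unit square;
  the degenerate case `D = 0` is a null set, so NO non-degeneracy hypothesis is carried;
* `setIntegral_parallelogram_eq_iterated_of_continuousOn` drops the integrability hypothesis;
* `volume_parallelogram` is the area `|D|`; `P = parallelogramParam a u v '' [0, 1]²` (`image_parallelogramParam_unitSquare`,
  via `convexJoin_segments`; the unit square is written `Icc 0 1 ×ˢ Icc 0 1`, no new name).

**Why here.** Certified cubature engines integrate over boxes; a parallelogram (affine image of the unit square) is
the simplest non-box region and the building block for affinely mapped product rules. Companion of
`Literature.MeasureTheory.Integral.TriangleIntegral` (triangles: affine map + Duffy's collapse). Mathlib supplies the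
change-of-variables theorem (`MeasureTheory.integral_image_eq_integral_abs_det_fderiv_smul`), `convexJoin_segments`
and `Measure.addHaar_image_continuousLinearMap`; the tree had no parallelogram box form.

Honest framing: this is infrastructure for shared numerical engines serving client cells; rigour lives in the
verifiers (the kernel-checked certificate that consumes the box form); every published number belongs to a client
cell's ledger, not to the engines group. Nothing here is claimed as new mathematics.

References: P. J. Davis, P. Rabinowitz, *Methods of Numerical Integration*, 2nd ed. (1984), Sect. 5.4
(5.4.7)–(5.4.8) (affine change of variables, constant Jacobian `|ae - bd|`, parallelograms), Sect. 5.6.1 (5.6.1.1)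
(iterated integrals); J. F. Hurley, *Intermediate Calculus* (1980), Sect. 5.2 Thm. 2.4 (Fubini on a rectangle).

AI-produced formalisation (H21 engines group, seat eng-quad-3 gen 66, 2026-08-24); Lean 4 + Mathlib, no `sorry`,
standard axioms only.
-/

open _root_.MeasureTheory Set intervalIntegral
open scoped Interval

noncomputable section

namespace Literature.MeasureTheory.Integral

/-! ### The unit square `[0, 1] × [0, 1]` (written `Icc 0 1 ×ˢ Icc 0 1` throughout; no new name is introduced —
`unitSquare` is taken by several unrelated declarations in the tree) -/

/-- The unit square has area `1`. [cite: Hurley1980, Sect. 5.2 Thm. 2.4] -/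
theorem volume_Icc01_prod_Icc01 : volume (Icc (0 : ℝ) 1 ×ˢ Icc (0 : ℝ) 1) = 1 := by
  rw [Measure.volume_eq_prod, Measure.prod_prod, Real.volume_Icc, sub_zero, ENNReal.ofReal_one, mul_one]

/-- A function continuous on the unit square is integrable on it. [cite: Hurley1980, Sect. 5.2 Thm. 2.4] -/
theorem _root_.ContinuousOn.integrableOn_Icc01_prod {g : ℝ × ℝ → ℝ} (hg : ContinuousOn g (Icc (0 : ℝ) 1 ×ˢ Icc (0 : ℝ) 1)) :
    IntegrableOn g (Icc (0 : ℝ) 1 ×ˢ Icc (0 : ℝ) 1) :=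
  hg.integrableOn_compact (isCompact_Icc.prod isCompact_Icc)

/-- **Fubini on the unit square** in interval form: `∫ q in [0,1]², g q = ∫ s in 0..1, ∫ t in 0..1, g (s, t)`
for `g` integrable on it. [cite: Hurley1980, Sect. 5.2 Thm. 2.4] [cite: DavisRabinowitz1984, Sect. 5.6.1 (5.6.1.1)] -/
theorem setIntegral_Icc01_prod_eq_iterated {g : ℝ × ℝ → ℝ} (hg : IntegrableOn g (Icc (0 : ℝ) 1 ×ˢ Icc (0 : ℝ) 1)) :
    ∫ q in Icc (0 : ℝ) 1 ×ˢ Icc (0 : ℝ) 1, g q = ∫ s in (0:ℝ)..1, ∫ t in (0:ℝ)..1, g (s, t) := by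
  have h : ∫ q in Icc (0 : ℝ) 1 ×ˢ Icc (0 : ℝ) 1, g q = ∫ s in Icc (0:ℝ) 1, ∫ t in Icc (0:ℝ) 1, g (s, t) := by
    rw [Measure.volume_eq_prod]
    exact setIntegral_prod g hg
  rw [h, intervalIntegral.integral_of_le zero_le_one, integral_Icc_eq_integral_Ioc]
  refine setIntegral_congr_fun measurableSet_Ioc fun s _ => ?_
  rw [intervalIntegral.integral_of_le zero_le_one, integral_Icc_eq_integral_Ioc]

/-! ### The affine parametrisation of a parallelogram -/

/-- The determinant of the edge vectors `u`, `v`: `u₁ v₂ - u₂ v₁` (the signed area; the constant Jacobian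
`ae - bd` of the affine map (5.4.7)). [cite: DavisRabinowitz1984, Sect. 5.4 (5.4.7)-(5.4.8)] -/
def parallelogramDet (u v : ℝ × ℝ) : ℝ := u.1 * v.2 - u.2 * v.1

/-- The linear part of the parametrisation: the matrix with columns `u`, `v`.
[cite: DavisRabinowitz1984, Sect. 5.4 (5.4.7)-(5.4.8)] -/
def parallelogramLinear (u v : ℝ × ℝ) : ℝ × ℝ →L[ℝ] ℝ × ℝ :=
  (Matrix.toLin (.finTwoProd ℝ) (.finTwoProd ℝ) !![u.1, v.1; u.2, v.2]).toContinuousLinearMap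

/-- The linear part in coordinates. [cite: DavisRabinowitz1984, Sect. 5.4 (5.4.7)-(5.4.8)] -/
theorem parallelogramLinear_apply (u v q : ℝ × ℝ) :
    parallelogramLinear u v q = (u.1 * q.1 + v.1 * q.2, u.2 * q.1 + v.2 * q.2) := by
  simp [parallelogramLinear, Matrix.toLin_finTwoProd_apply]

/-- The linear part as a combination of the edge vectors: `q.1 • u + q.2 • v`.
[cite: DavisRabinowitz1984, Sect. 5.4 (5.4.7)-(5.4.8)] -/
theorem parallelogramLinear_apply_eq_smul (u v q : ℝ × ℝ) : parallelogramLinear u v q = q.1 • u + q.2 • v := by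
  rw [parallelogramLinear_apply]
  ext <;> simp only [Prod.fst_add, Prod.snd_add, Prod.smul_fst, Prod.smul_snd, smul_eq_mul] <;> ring

/-- The Jacobian determinant is the constant `parallelogramDet u v` (Davis–Rabinowitz (5.4.8)).
[cite: DavisRabinowitz1984, Sect. 5.4 (5.4.7)-(5.4.8)] -/
theorem det_parallelogramLinear (u v : ℝ × ℝ) : (parallelogramLinear u v).det = parallelogramDet u v := by
  simp only [parallelogramLinear, LinearMap.det_toContinuousLinearMap, LinearMap.det_toLin, Matrix.det_fin_two_of,
    parallelogramDet]
  ring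

/-- The affine parametrisation of the parallelogram by the unit square: `(s, t) ↦ a + s • u + t • v`
(Davis–Rabinowitz (5.4.7)). [cite: DavisRabinowitz1984, Sect. 5.4 (5.4.7)-(5.4.8)] -/
def parallelogramParam (a u v : ℝ × ℝ) (q : ℝ × ℝ) : ℝ × ℝ := a + q.1 • u + q.2 • v

/-- The parametrisation is the translate by `a` of its linear part. [cite: DavisRabinowitz1984, Sect. 5.4 (5.4.7)-(5.4.8)] -/
theorem parallelogramParam_eq (a u v q : ℝ × ℝ) : parallelogramParam a u v q = a + parallelogramLinear u v q := by
  rw [parallelogramLinear_apply_eq_smul, parallelogramParam, add_assoc]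

/-- The parametrisation as `(a + ·) ∘ parallelogramLinear u v`. [cite: DavisRabinowitz1984, Sect. 5.4 (5.4.7)-(5.4.8)] -/
theorem parallelogramParam_eq_comp (a u v : ℝ × ℝ) :
    parallelogramParam a u v = (fun p => a + p) ∘ (parallelogramLinear u v) :=
  funext (parallelogramParam_eq a u v)

/-- The vertices: `(0,0) ↦ a`, `(1,0) ↦ a + u`, `(0,1) ↦ a + v`, `(1,1) ↦ a + u + v`.
[cite: DavisRabinowitz1984, Sect. 5.4 (5.4.7)-(5.4.8)] -/
theorem parallelogramParam_vertices (a u v : ℝ × ℝ) :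
    parallelogramParam a u v (0, 0) = a ∧ parallelogramParam a u v (1, 0) = a + u ∧
      parallelogramParam a u v (0, 1) = a + v ∧ parallelogramParam a u v (1, 1) = a + u + v := by
  refine ⟨?_, ?_, ?_, ?_⟩ <;> ext <;> simp [parallelogramParam]

/-- The parametrisation is continuous. [cite: DavisRabinowitz1984, Sect. 5.4 (5.4.7)-(5.4.8)] -/
theorem continuous_parallelogramParam (a u v : ℝ × ℝ) : Continuous (parallelogramParam a u v) := by
  unfold parallelogramParam; fun_prop

/-- The parametrisation has the constant derivative `parallelogramLinear u v`.
[cite: DavisRabinowitz1984, Sect. 5.4 (5.4.7)-(5.4.8)] -/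
theorem hasFDerivAt_parallelogramParam (a u v q : ℝ × ℝ) :
    HasFDerivAt (parallelogramParam a u v) (parallelogramLinear u v) q := by
  rw [parallelogramParam_eq_comp]
  exact ((parallelogramLinear u v).hasFDerivAt).const_add a

/-- For a non-degenerate parallelogram (`parallelogramDet u v ≠ 0`) the parametrisation is injective (Cramer's
rule). [cite: DavisRabinowitz1984, Sect. 5.4 (5.4.7)-(5.4.8)] -/
theorem injective_parallelogramParam {a u v : ℝ × ℝ} (hD : parallelogramDet u v ≠ 0) :
    Function.Injective (parallelogramParam a u v) := by
  intro p q hpq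
  simp only [parallelogramParam, Prod.ext_iff, Prod.fst_add, Prod.snd_add, Prod.smul_fst, Prod.smul_snd,
    smul_eq_mul] at hpq
  obtain ⟨h1, h2⟩ := hpq
  have e1 : (p.1 - q.1) * parallelogramDet u v = 0 := by
    unfold parallelogramDet; linear_combination v.2 * h1 - v.1 * h2
  have e2 : (p.2 - q.2) * parallelogramDet u v = 0 := by
    unfold parallelogramDet; linear_combination u.1 * h2 - u.2 * h1
  exact Prod.ext (sub_eq_zero.1 ((mul_eq_zero.1 e1).resolve_right hD))
    (sub_eq_zero.1 ((mul_eq_zero.1 e2).resolve_right hD))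

/-- **The image of the unit square is the closed parallelogram** `convexHull ℝ {a, a + u, a + v, a + u + v}` (for
any `u`, `v`, degenerate or not): the parallelogram is the convex join of the parallel edges `[a, a + u]` and
`[a + v, a + u + v]` (`convexJoin_segments`), and `a + s • u + t • v` is the point at parameter `t` of the segment from
`a + s • u` to `a + v + s • u`. [cite: DavisRabinowitz1984, Sect. 5.4 (5.4.7)-(5.4.8)] -/
theorem image_parallelogramParam_unitSquare (a u v : ℝ × ℝ) :
    parallelogramParam a u v '' (Icc (0 : ℝ) 1 ×ˢ Icc (0 : ℝ) 1) = convexHull ℝ {a, a + u, a + v, a + u + v} := by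
  rw [← convexJoin_segments]
  ext p
  rw [mem_convexJoin]
  constructor
  · rintro ⟨q, ⟨⟨hs0, hs1⟩, ht0, ht1⟩, rfl⟩
    refine ⟨a + q.1 • u, ?_, a + v + q.1 • u, ?_, ?_⟩
    · rw [segment_eq_image' ℝ]
      exact ⟨q.1, ⟨hs0, hs1⟩, by simp only [add_sub_cancel_left]⟩
    · rw [segment_eq_image' ℝ]
      exact ⟨q.1, ⟨hs0, hs1⟩, by module⟩
    · rw [segment_eq_image' ℝ]
      exact ⟨q.2, ⟨ht0, ht1⟩, by unfold parallelogramParam; module⟩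
  · rintro ⟨x, hx, y, hy, hp⟩
    rw [segment_eq_image' ℝ] at hx hy hp
    obtain ⟨s, ⟨hs0, hs1⟩, rfl⟩ := hx
    obtain ⟨s', ⟨hs'0, hs'1⟩, rfl⟩ := hy
    obtain ⟨θ, ⟨hθ0, hθ1⟩, rfl⟩ := hp
    refine ⟨((1 - θ) * s + θ * s', θ), ⟨⟨by nlinarith, by nlinarith⟩, hθ0, hθ1⟩, ?_⟩
    · unfold parallelogramParam
      module

/-- The closed parallelogram is compact. [cite: DavisRabinowitz1984, Sect. 5.4 (5.4.7)-(5.4.8)] -/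
theorem isCompact_parallelogram (a u v : ℝ × ℝ) :
    IsCompact (convexHull ℝ ({a, a + u, a + v, a + u + v} : Set (ℝ × ℝ))) :=
  ((((Set.finite_singleton (a + u + v)).insert (a + v)).insert (a + u)).insert a).isCompact_convexHull ℝ

/-- A function continuous on the closed parallelogram is integrable on it.
[cite: DavisRabinowitz1984, Sect. 5.4 (5.4.7)-(5.4.8)] -/
theorem _root_.ContinuousOn.integrableOn_parallelogram {a u v : ℝ × ℝ} {f : ℝ × ℝ → ℝ}
    (hf : ContinuousOn f (convexHull ℝ {a, a + u, a + v, a + u + v})) :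
    IntegrableOn f (convexHull ℝ {a, a + u, a + v, a + u + v}) :=
  hf.integrableOn_compact (isCompact_parallelogram a u v)

/-! ### The change of variables -/

/-- **The area of a parallelogram**: `volume (convexHull ℝ {a, a + u, a + v, a + u + v}) = |parallelogramDet u v|`
(for degenerate ones both sides vanish; no injectivity is needed for the measure of a linear image).
[cite: DavisRabinowitz1984, Sect. 5.4 (5.4.7)-(5.4.8)] -/
theorem volume_parallelogram (a u v : ℝ × ℝ) :
    volume (convexHull ℝ ({a, a + u, a + v, a + u + v} : Set (ℝ × ℝ))) = ENNReal.ofReal |parallelogramDet u v| := by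
  rw [← image_parallelogramParam_unitSquare, parallelogramParam_eq_comp, Set.image_comp, Set.image_add_left,
    measure_preimage_add, Measure.addHaar_image_continuousLinearMap, volume_Icc01_prod_Icc01, mul_one]
  have hdet : LinearMap.det (parallelogramLinear u v : ℝ × ℝ →ₗ[ℝ] ℝ × ℝ) = parallelogramDet u v :=
    det_parallelogramLinear u v
  rw [hdet]

/-- A degenerate parallelogram (`parallelogramDet u v = 0`, parallel edges) is a null set.
[cite: DavisRabinowitz1984, Sect. 5.4 (5.4.7)-(5.4.8)] -/
theorem volume_parallelogram_of_det_eq_zero {a u v : ℝ × ℝ} (hD : parallelogramDet u v = 0) :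
    volume (convexHull ℝ ({a, a + u, a + v, a + u + v} : Set (ℝ × ℝ))) = 0 := by
  rw [volume_parallelogram, hD, abs_zero, ENNReal.ofReal_zero]

/-- Over a degenerate parallelogram every integral vanishes. [cite: DavisRabinowitz1984, Sect. 5.4 (5.4.7)-(5.4.8)] -/
theorem setIntegral_parallelogram_of_det_eq_zero {a u v : ℝ × ℝ} (hD : parallelogramDet u v = 0)
    (f : ℝ × ℝ → ℝ) : ∫ p in convexHull ℝ {a, a + u, a + v, a + u + v}, f p = 0 :=
  setIntegral_measure_zero f (volume_parallelogram_of_det_eq_zero hD)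

/-- **Affine change of variables onto the unit square** (non-degenerate case, no integrability hypothesis):
`∫ p in P, f p = |parallelogramDet u v| * ∫ q in [0,1]², f (parallelogramParam a u v q)`.
[cite: DavisRabinowitz1984, Sect. 5.4 (5.4.7)-(5.4.8)] -/
theorem setIntegral_parallelogram_eq_setIntegral_unitSquare {a u v : ℝ × ℝ} (hD : parallelogramDet u v ≠ 0)
    (f : ℝ × ℝ → ℝ) :
    ∫ p in convexHull ℝ {a, a + u, a + v, a + u + v}, f p =
      |parallelogramDet u v| * ∫ q in Icc (0 : ℝ) 1 ×ˢ Icc (0 : ℝ) 1, f (parallelogramParam a u v q) := by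
  rw [← image_parallelogramParam_unitSquare,
    integral_image_eq_integral_abs_det_fderiv_smul volume (measurableSet_Icc.prod measurableSet_Icc)
      (fun q _ => (hasFDerivAt_parallelogramParam a u v q).hasFDerivWithinAt) (injective_parallelogramParam hD).injOn f]
  simp only [det_parallelogramLinear, smul_eq_mul]
  exact integral_const_mul _ _

/-- Integrability transfers along the affine map (non-degenerate case).
[cite: DavisRabinowitz1984, Sect. 5.4 (5.4.7)-(5.4.8)] -/
theorem integrableOn_parallelogram_iff {a u v : ℝ × ℝ} (hD : parallelogramDet u v ≠ 0) (f : ℝ × ℝ → ℝ) :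
    IntegrableOn f (convexHull ℝ {a, a + u, a + v, a + u + v}) ↔
      IntegrableOn (fun q => f (parallelogramParam a u v q)) (Icc (0 : ℝ) 1 ×ˢ Icc (0 : ℝ) 1) := by
  rw [← image_parallelogramParam_unitSquare,
    integrableOn_image_iff_integrableOn_abs_det_fderiv_smul volume (measurableSet_Icc.prod measurableSet_Icc)
      (fun q _ => (hasFDerivAt_parallelogramParam a u v q).hasFDerivWithinAt) (injective_parallelogramParam hD).injOn f]
  simp only [det_parallelogramLinear, smul_eq_mul]
  have hD' : |parallelogramDet u v| ≠ 0 := abs_ne_zero.2 hD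
  constructor
  · intro h
    refine (h.const_mul |parallelogramDet u v|⁻¹).congr (ae_of_all _ fun q => ?_)
    show |parallelogramDet u v|⁻¹ * (|parallelogramDet u v| * f (parallelogramParam a u v q)) =
      f (parallelogramParam a u v q)
    rw [← mul_assoc, inv_mul_cancel₀ hD', one_mul]
  · intro h
    exact h.const_mul _

/-- **Integral over a parallelogram as a BOX integral**: for any `a u v` and `f` integrable on
`P = convexHull ℝ {a, a + u, a + v, a + u + v}`,
`∫ p in P, f p = |parallelogramDet u v| * ∫ s in 0..1, ∫ t in 0..1, f (a + s • u + t • v)`.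
[cite: DavisRabinowitz1984, Sect. 5.4 (5.4.7)-(5.4.8)] [cite: DavisRabinowitz1984, Sect. 5.6.1 (5.6.1.1)] -/
theorem setIntegral_parallelogram_eq_iterated {a u v : ℝ × ℝ} {f : ℝ × ℝ → ℝ}
    (hf : IntegrableOn f (convexHull ℝ {a, a + u, a + v, a + u + v})) :
    ∫ p in convexHull ℝ {a, a + u, a + v, a + u + v}, f p =
      |parallelogramDet u v| * ∫ s in (0:ℝ)..1, ∫ t in (0:ℝ)..1, f (a + s • u + t • v) := by
  rcases eq_or_ne (parallelogramDet u v) 0 with hD | hD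
  · rw [setIntegral_parallelogram_of_det_eq_zero hD, hD, abs_zero, zero_mul]
  · rw [setIntegral_parallelogram_eq_setIntegral_unitSquare hD,
      setIntegral_Icc01_prod_eq_iterated ((integrableOn_parallelogram_iff hD f).1 hf)]
    rfl

/-- The continuous case of `setIntegral_parallelogram_eq_iterated`: no integrability side condition — the form
consumed by certified box cubature. [cite: DavisRabinowitz1984, Sect. 5.4 (5.4.7)-(5.4.8)] -/
theorem setIntegral_parallelogram_eq_iterated_of_continuousOn {a u v : ℝ × ℝ} {f : ℝ × ℝ → ℝ}
    (hf : ContinuousOn f (convexHull ℝ {a, a + u, a + v, a + u + v})) :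
    ∫ p in convexHull ℝ {a, a + u, a + v, a + u + v}, f p =
      |parallelogramDet u v| * ∫ s in (0:ℝ)..1, ∫ t in (0:ℝ)..1, f (a + s • u + t • v) :=
  setIntegral_parallelogram_eq_iterated hf.integrableOn_parallelogram

/-- **Vertex form**: the parallelogram with consecutive vertices `a`, `b`, `b + d - a`, `d` (edge vectors `b - a`,
`d - a`): `∫ p in convexHull ℝ {a, b, d, b + d - a}, f p =
|(b₁ - a₁)(d₂ - a₂) - (b₂ - a₂)(d₁ - a₁)| * ∫ s in 0..1, ∫ t in 0..1, f (a + s • (b - a) + t • (d - a))`.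
[cite: DavisRabinowitz1984, Sect. 5.4 (5.4.7)-(5.4.8)] -/
theorem setIntegral_parallelogram_vertices_eq_iterated {a b d : ℝ × ℝ} {f : ℝ × ℝ → ℝ}
    (hf : IntegrableOn f (convexHull ℝ {a, b, d, b + d - a})) :
    ∫ p in convexHull ℝ {a, b, d, b + d - a}, f p =
      |(b.1 - a.1) * (d.2 - a.2) - (b.2 - a.2) * (d.1 - a.1)| *
        ∫ s in (0:ℝ)..1, ∫ t in (0:ℝ)..1, f (a + s • (b - a) + t • (d - a)) := by
  have hset : ({a, b, d, b + d - a} : Set (ℝ × ℝ)) = {a, a + (b - a), a + (d - a), a + (b - a) + (d - a)} := by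
    rw [add_sub_cancel, add_sub_cancel, ← add_sub_assoc]
  rw [hset] at hf ⊢
  rw [setIntegral_parallelogram_eq_iterated hf]
  rfl

end Literature.MeasureTheory.Integral
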